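import Literature.NumberTheory.Transcendental.TubbsPeriodsValues
import Literature.NumberTheory.Transcendental.TubbsPeriodsAnalytic
import Literature.NumberTheory.Transcendental.TubbsPeriodsTaylor
import Literature.NumberTheory.Transcendental.BWEnvelope
import Literature.NumberTheory.Transcendental.ChudnovskySiegel
import HarnessLib

/-!
# Tubbs 1990, Theorem 4 (periods form) — the construction at level `m`

Topic `Literature/NumberTheory/Transcendental` (trunk T-TRANSCEND). Fifth file of the discharge of
`Literature.NumberTheory.Transcendental.Tubbs1990_thm4_periods` (Tubbs 1990, Thm 4 = Chudnovsky
1984, Ch. 7, Thm 4.1 (i), p. 318): one level of Gel'fond's method, in the pattern of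
`BWConstruction.lean`.

**Data** (`Setup`): a lattice basis `L`, `c ≠ 0`, a transcendental `θ` and an envelope over
`ℚ(θ)` of the seven numbers `x = (ω₁, ω₂, c, e^{cω₁}, e^{cω₂}, e₁, g₂/2)` (this is what
"`trdeg ≤ 1`" provides, see `TubbsPeriodsMain.lean`).

**Parameters at level `m`** (Chudnovsky 1984, p. 318, with the exponents doubled so that the
final comparison has polynomial room): the auxiliary function has degrees `< La = C_a m⁶` in
`z - ω₁/2`, `< L0 = m²` in `e^{c(z-ω₁/2)}` and `< L1 = m⁶` in `℘ - e₁`; it is constructed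
(Siegel's lemma over `ℤ[θ]`, `siegel_step`) to vanish to order `T = K₁ m⁶` at the `m⁸` points
`z_n`, `n ∈ [0, m⁴)²`. Here `K₁ = C'' 2^{k_max}` with `C'' = ⌈2C_F⌉ + 2` (`C_F` the constant of
the fundamental analytic bound) and `2^{k_max} ≥ 64 C'' d²` (`d = [ℚ(θ)(x) : ℚ(θ)]`),
`C_a = 4K₁d²`.

**The extrapolation** (`exists_small_value`), replacing the zero estimate: if `F` vanishes to
order `≥ T/2^k` on the box `[0, 2^k m⁴)²` (`Hvan k`), the fundamental bound
(`TubbsPeriodsAnalytic.lean`) makes all derivatives of order `< T` at the points of the doubled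
box smaller than `exp(-2^{k_max} m¹⁴)` (up to factors `exp O(m¹⁰)`), so either one of them of
order `< T/2^{k+1}` is a nonzero small value, or `Hvan (k+1)` holds; and `Hvan k_max`
(vanishing to order `≥ C'' m⁶ ≥ 2 L1` on `[0, 2^{k_max} m⁴)²`) contradicts Tijdeman's lemma
through the uniform Taylor expansion (`TubbsPeriodsTaylor.lean`), because
`2 · 4^{k_max} > 30 · C_a · 2^{-k_max} … ` — precisely `2 (2^{k_max})² m⁸ > 30 (C_a m⁸ + O(m⁶))`
by the choice `2^{k_max} ≥ 64 C'' d²`.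

**The norm** (`level_struct`): the nonzero small value `ξ = F^{(t)}(z_n)` is
`P(θ; x)` for an integer polynomial `P`, and `Q = det (homEval N b n P) ∈ ℤ[T]` satisfies
`Q(θ) ≠ 0`, `deg Q = O(m⁶)`, `log ‖Q‖₁ = O(m⁷)`, `log |Q(θ)| ≤ O(m⁷) - 2^{k_max} m¹⁴`
(the explicit shapes are `natDegree_le`, `zl1_le`, `valB`). The comparison of these bounds and
Gel'fond's criterion are in `TubbsPeriodsMain.lean`.

## References

* G. V. Chudnovsky, *Contributions to the theory of transcendental numbers* (1984), Ch. 7,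
  Thm 4.1 (i), p. 318; §2 pp. 306–308. [Chudnovsky1984]
* R. Tubbs, J. Number Theory 35 (1990), Thm 4 (p. 112), §5. [Tubbs1990]
* A. Baker, *Transcendental Number Theory* (1975), Ch. 12 §5. [BakerTNT1975]
-/

noncomputable section

open scoped Polynomial Nat
open Complex Finset MvPolynomial Matrix

namespace Literature.NumberTheory.Transcendental.TubbsPeriods

open Literature.NumberTheory.Transcendental.BrownawellWaldschmidt (Envelope homEval evC evC_C
  evC_map_C seminorm_homEval_entry_le natDegree_homEval_entry_le homEval_sum homEval_C_mul)
open Literature.NumberTheory.Transcendental.Chudnovsky (zl1 l1 wnorm siegel_poly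
  natDegree_det_le_of_entry zl1_det_le_of_entry norm_det_le_of_vecMul zl1_le_of_coeff_le
  norm_aeval_le_zl1 abs_coeff_le_zl1 wnorm_map_le wnorm_sum_le wnorm_mul_le wnorm_C zl1_C
  normRingSeminorm_int_apply zl1_one wnorm_nonneg)

/-! ### The data -/

/-- **The data of the proof by contradiction**: a lattice basis `L`, `c ≠ 0`, a transcendental
`θ`, and an envelope over `ℚ(θ)` of the seven numbers `(ω₁, ω₂, c, e^{cω₁}, e^{cω₂}, e₁, g₂/2)`.
[cite: Chudnovsky1984, Ch. 7 Thm 4.1 p. 318] -/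
structure Setup where
  /-- the lattice basis -/
  L : PeriodPair
  /-- the exponent `c` (`φ` in Chudnovsky, `λ` in Tubbs) -/
  c : ℂ
  hc : c ≠ 0
  /-- the transcendental parameter -/
  θ : ℂ
  hθ : Transcendental ℚ θ
  /-- the envelope of the seven generators over `ℚ(θ)` -/
  E : Envelope θ (xv L c)

namespace Setup

variable (S : Setup)

/-- The degree `d = [K : ℚ(θ)]`. [folklore] -/
def d : ℕ := S.E.d

/-- Auxiliary (`one_le_d`). [folklore] -/
lemma one_le_d : 1 ≤ S.d := S.E.d_pos

/-! ### The constants -/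

/-- The constant `C_F` of the fundamental analytic bound
(`norm_iteratedDeriv_F_zpt_le_of_zeros`). [folklore] -/
def CF : ℝ := (norm_iteratedDeriv_F_zpt_le_of_zeros S.L S.c).choose

/-- `0 ≤ C_F`. [folklore] -/
lemma CF_nonneg : 0 ≤ S.CF := (norm_iteratedDeriv_F_zpt_le_of_zeros S.L S.c).choose_spec.1

/-- The fundamental analytic bound with the constant `C_F`. [cite: Chudnovsky1984, Ch. 7 Thm 4.1 p. 318] -/
lemma CF_spec : ∀ (La L0 L1 X T' : ℕ), 1 ≤ X → ∀ p : Lam La L0 L1 → ℂ,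
    (∀ n : ℕ × ℕ, n.1 < X → n.2 < X → ∀ t < T', iteratedDeriv t (F S.L S.c p) (zpt S.L n) = 0) →
    ∀ n : ℕ × ℕ, n.1 < 2 * X → n.2 < 2 * X → ∀ t : ℕ,
      ‖iteratedDeriv t (F S.L S.c p) (zpt S.L n)‖ ≤
        ‖p‖ * Fintype.card (Lam La L0 L1) * t ! *
          Real.exp (S.CF * (t + La * X + L0 * X + L1 * X ^ 2)) * (1 / 2) ^ (T' * X ^ 2) :=
  (norm_iteratedDeriv_F_zpt_le_of_zeros S.L S.c).choose_spec.2

/-- `C'' = ⌈2 C_F⌉ + 2`: the ratio `T/(2^{k_max} L1)`. [folklore] -/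
def Cpp : ℕ := ⌈2 * S.CF⌉₊ + 2

/-- `2 ≤ C''`. [folklore] -/
lemma two_le_Cpp : 2 ≤ S.Cpp := Nat.le_add_left _ _

/-- `2 C_F + 2 ≤ C''`. [folklore] -/
lemma two_mul_CF_add_two_le : 2 * S.CF + 2 ≤ (S.Cpp : ℝ) := by
  unfold Cpp
  push_cast
  linarith [Nat.le_ceil (2 * S.CF)]

/-- `k_max`: the number of extrapolation steps, `2^{k_max} ≥ 64 C'' d²`. [folklore] -/
def kmax : ℕ := Nat.clog 2 (64 * S.Cpp * S.d ^ 2)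

/-- `K₂ = 2^{k_max}`. [folklore] -/
def K2 : ℕ := 2 ^ S.kmax

/-- `64 C'' d² ≤ K₂`. [folklore] -/
lemma le_K2 : 64 * S.Cpp * S.d ^ 2 ≤ S.K2 := Nat.le_pow_clog one_lt_two _

/-- `1 ≤ K₂`. [folklore] -/
lemma one_le_K2 : 1 ≤ S.K2 := Nat.one_le_two_pow

/-- `K₁ = C'' K₂`: `T = K₁ m⁶`. [folklore] -/
def K₁ : ℕ := S.Cpp * S.K2

/-- `1 ≤ K₁`. [folklore] -/
lemma one_le_K₁ : 1 ≤ S.K₁ := by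
  unfold K₁
  have := S.two_le_Cpp
  have := S.one_le_K2
  nlinarith

/-- `C_a = 4 K₁ d²`: `La = C_a m⁶`. [folklore] -/
def Ca : ℕ := 4 * S.K₁ * S.d ^ 2

/-- `1 ≤ C_a`. [folklore] -/
lemma one_le_Ca : 1 ≤ S.Ca := by
  unfold Ca
  have := S.one_le_K₁
  have := S.one_le_d
  nlinarith

/-- `C_n = 2K₂ + C_a + 1 + K₁`: the degree budget is `n = C_n m⁶`. [folklore] -/
def Cn : ℕ := 2 * S.K2 + S.Ca + 1 + S.K₁

/-- `1 ≤ C_n`. [folklore] -/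
lemma one_le_Cn : 1 ≤ S.Cn := by unfold Cn; omega

/-! ### Parameters at level `m` -/

section Params

variable (m : ℕ)

/-- `L0 = m²`: the degree in `e^{c(z-ω₁/2)}`. [folklore] -/
def L0 : ℕ := m ^ 2

/-- `L1 = m⁶`: the degree in `℘ - e₁`. [folklore] -/
def L1 : ℕ := m ^ 6

/-- `La = C_a m⁶`: the degree in `z - ω₁/2`. [folklore] -/
def La : ℕ := S.Ca * m ^ 6

/-- `T = K₁ m⁶`: the order of vanishing in Siegel's lemma. [folklore] -/
def T : ℕ := S.K₁ * m ^ 6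

/-- `T_k = C'' 2^{k_max - k} m⁶ = T / 2^k`: the order at extrapolation step `k`. [folklore] -/
def Tk (k : ℕ) : ℕ := S.Cpp * 2 ^ (S.kmax - k) * m ^ 6

/-- `X_k = 2^k m⁴`: the side of the box at extrapolation step `k`. [folklore] -/
def Xk (k : ℕ) : ℕ := 2 ^ k * m ^ 4

/-- `n = C_n m⁶`: the degree budget of the value polynomials. [folklore] -/
def nDeg : ℕ := S.Cn * m ^ 6

/-- The index set of the unknowns. [folklore] -/
abbrev Λ : Type := Lam (S.La m) (L0 m) (L1 m)

/-- The mixed polynomial `∑_l C(pp_l) · V_{t,n,l} ∈ ℤ[T][a₀,…,a₆]`. [folklore] -/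
def Pmix (pp : S.Λ m → ℤ[X]) (t : ℕ) (n : ℕ × ℕ) : MvPolynomial (Fin 7) ℤ[X] :=
  ∑ l : S.Λ m, MvPolynomial.C (pp l) * MvPolynomial.map (Polynomial.C : ℤ →+* ℤ[X]) (V t n l)

/-- `T_0 = T`. [folklore] -/
lemma Tk_zero : S.Tk m 0 = S.T m := by unfold Tk T K₁ K2; rw [Nat.sub_zero]

/-- `X_0 = m⁴`. [folklore] -/
lemma Xk_zero : Xk m 0 = m ^ 4 := by unfold Xk; ring

/-- `X_{k+1} = 2 X_k`. [folklore] -/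
lemma Xk_succ (k : ℕ) : Xk m (k + 1) = 2 * Xk m k := by unfold Xk; ring

/-- `X_k ≤ K₂ m⁴` for `k ≤ k_max`. [folklore] -/
lemma Xk_le {k : ℕ} (hk : k ≤ S.kmax) : Xk m k ≤ S.K2 * m ^ 4 := by
  unfold Xk K2
  exact Nat.mul_le_mul_right _ (Nat.pow_le_pow_right (by norm_num) hk)

/-- `T_k ≤ T`. [folklore] -/
lemma Tk_le (k : ℕ) : S.Tk m k ≤ S.T m := by
  unfold Tk T K₁ K2
  have : 2 ^ (S.kmax - k) ≤ 2 ^ S.kmax := Nat.pow_le_pow_right (by norm_num) (Nat.sub_le _ _)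
  calc S.Cpp * 2 ^ (S.kmax - k) * m ^ 6 ≤ S.Cpp * 2 ^ S.kmax * m ^ 6 := by gcongr
    _ = _ := by ring

/-- `2^{k+1} T_{k+1} = 2^k T_k`-type identity: `T_k = 2 T_{k+1}` for `k < k_max`. [folklore] -/
lemma Tk_eq_two_mul {k : ℕ} (hk : k < S.kmax) : S.Tk m k = 2 * S.Tk m (k + 1) := by
  unfold Tk
  have : S.kmax - k = (S.kmax - (k + 1)) + 1 := by omega
  rw [this, pow_succ]
  ring

/-- `2 L1 ≤ T_{k_max}` (`C'' ≥ 2`). [folklore] -/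
lemma two_mul_L1_le_Tk_kmax : 2 * L1 m ≤ S.Tk m S.kmax := by
  unfold L1 Tk
  rw [Nat.sub_self, pow_zero, mul_one]
  exact Nat.mul_le_mul_right _ S.two_le_Cpp

end Params

/-! ### The value identity -/

section Values

variable (m : ℕ)

/-- **The value identity**: `evC θ x (Pmix pp t n) = F_p^{(t)}(z_n)` for the coefficient family
`p = pp(θ)`. [cite: Chudnovsky1984, Ch. 7 Thm 4.1 p. 318] -/
theorem evC_Pmix (pp : S.Λ m → ℤ[X]) (t : ℕ) (n : ℕ × ℕ) :
    evC S.θ (xv S.L S.c) (S.Pmix m pp t n) =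
      iteratedDeriv t (F S.L S.c (fun l => Polynomial.aeval S.θ (pp l))) (zpt S.L n) := by
  rw [iteratedDeriv_F_zpt, Pmix, map_sum]
  refine Finset.sum_congr rfl fun l _ => ?_
  rw [map_mul, evC_C, evC_map_C]
  rfl

/-- The coefficients of `Pmix`. [folklore] -/
theorem coeff_Pmix (pp : S.Λ m → ℤ[X]) (t : ℕ) (n : ℕ × ℕ) (α : Fin 7 →₀ ℕ) :
    (S.Pmix m pp t n).coeff α = ∑ l, pp l * Polynomial.C ((V t n l).coeff α) := by
  rw [Pmix, MvPolynomial.coeff_sum]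
  refine Finset.sum_congr rfl fun l _ => ?_
  rw [MvPolynomial.coeff_C_mul, MvPolynomial.coeff_map]

/-- Degree of a monomial of `V t n l` for `t < T`, `n₁, n₂ ≤ K₂ m⁴`, `l ∈ Λ`: `≤ n = C_n m⁶`.
[folklore] -/
theorem degree_le_of_mem_support_Vl {t : ℕ} (ht : t < S.T m) {n : ℕ × ℕ} (hn1 : n.1 ≤ S.K2 * m ^ 4)
    (hn2 : n.2 ≤ S.K2 * m ^ 4) (l : S.Λ m) {α : Fin 7 →₀ ℕ} (hα : α ∈ (V t n l).support) :
    α.degree ≤ S.nDeg m := by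
  have h1 := degree_le_of_mem_support_V t n l hα
  have hi : (l.1 : ℕ) < S.Ca * m ^ 6 := l.1.2
  have hj : (l.2.1 : ℕ) < m ^ 2 := l.2.1.2
  have hk : (l.2.2 : ℕ) < m ^ 6 := l.2.2.2
  have hT : t < S.K₁ * m ^ 6 := ht
  have hsum : n.1 + n.2 ≤ 2 * (S.K2 * m ^ 4) := by omega
  have hj' : (n.1 + n.2) * (l.2.1 : ℕ) ≤ 2 * (S.K2 * m ^ 4) * m ^ 2 := Nat.mul_le_mul hsum hj.le
  have hm : 2 * (S.K2 * m ^ 4) * m ^ 2 = 2 * (S.K2 * m ^ 6) := by ring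
  rw [hm] at hj'
  have hn : S.nDeg m = 2 * (S.K2 * m ^ 6) + S.Ca * m ^ 6 + m ^ 6 + S.K₁ * m ^ 6 := by
    unfold nDeg Cn; ring
  rw [hn]
  omega

/-- Monomials of `Pmix pp t n` have degree `≤ n` (same hypotheses). [folklore] -/
theorem degree_le_of_mem_support_Pmix (pp : S.Λ m → ℤ[X]) {t : ℕ} (ht : t < S.T m) {n : ℕ × ℕ}
    (hn1 : n.1 ≤ S.K2 * m ^ 4) (hn2 : n.2 ≤ S.K2 * m ^ 4) {α : Fin 7 →₀ ℕ}
    (hα : α ∈ (S.Pmix m pp t n).support) : α.degree ≤ S.nDeg m := by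
  rw [MvPolynomial.mem_support_iff, coeff_Pmix] at hα
  obtain ⟨l, -, hl⟩ := Finset.exists_ne_zero_of_sum_ne_zero hα
  have hlα : α ∈ (V t n l).support := by
    rw [MvPolynomial.mem_support_iff]
    intro h0
    exact hl (by rw [h0, map_zero, mul_zero])
  exact S.degree_le_of_mem_support_Vl m ht hn1 hn2 l hlα

/-- `homEval` of `Pmix` is the corresponding combination. [folklore] -/
theorem homEval_Pmix (pp : S.Λ m → ℤ[X]) (t : ℕ) (n : ℕ × ℕ) {dd : ℕ}
    (N : Fin 7 → Matrix (Fin dd) (Fin dd) ℤ[X]) (b : ℤ[X]) (k : ℕ) :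
    homEval N b k (S.Pmix m pp t n) =
      ∑ l, pp l • homEval N b k (MvPolynomial.map (Polynomial.C : ℤ →+* ℤ[X]) (V t n l)) := by
  rw [Pmix, homEval_sum]
  refine Finset.sum_congr rfl fun l _ => ?_
  rw [homEval_C_mul]

end Values

/-! ### Envelope bounds and the bookkeeping constants -/

/-- A common degree bound `δ₀` for the envelope data. [folklore] -/
def δ₀ : ℕ := S.E.exists_bounds.choose

/-- A common height bound `H₀ ≥ 1` for the envelope data. [folklore] -/
def H₀ : ℝ := S.E.exists_bounds.choose_spec.choose

/-- Auxiliary (`natDegree_N_le`). [folklore] -/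
lemma natDegree_N_le : ∀ l i j, (S.E.N l i j).natDegree ≤ S.δ₀ :=
  S.E.exists_bounds.choose_spec.choose_spec.1

/-- Auxiliary (`natDegree_b_le`). [folklore] -/
lemma natDegree_b_le : S.E.b.natDegree ≤ S.δ₀ :=
  S.E.exists_bounds.choose_spec.choose_spec.2.1

/-- Auxiliary (`one_le_H₀`). [folklore] -/
lemma one_le_H₀ : 1 ≤ S.H₀ :=
  S.E.exists_bounds.choose_spec.choose_spec.2.2.1

/-- `H₀ ≥ 0`. [folklore] -/
lemma H₀_nonneg : 0 ≤ S.H₀ := le_trans zero_le_one S.one_le_H₀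

/-- Auxiliary (`zl1_N_le`). [folklore] -/
lemma zl1_N_le : ∀ l i j, zl1 (S.E.N l i j) ≤ S.H₀ :=
  S.E.exists_bounds.choose_spec.choose_spec.2.2.2.1

/-- Auxiliary (`zl1_b_le`). [folklore] -/
lemma zl1_b_le : zl1 S.E.b ≤ S.H₀ :=
  S.E.exists_bounds.choose_spec.choose_spec.2.2.2.2

section Bounds

variable (m : ℕ)

/-- `A₀ = n δ₀ + 1`: the bound for the degrees of the unknown polynomials `pp_l ∈ ℤ[T]`.
[folklore] -/
def A₀ : ℕ := S.nDeg m * S.δ₀ + 1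

/-- The `ℓ¹`-bound for the value polynomials: `(26 C_n m⁶)^T (2 K₂ m⁴ + 1)^n`. [folklore] -/
def l1B : ℝ := ((26 * S.Cn : ℕ) * (m : ℝ) ^ 6) ^ S.T m * ((2 * S.K2 : ℕ) * (m : ℝ) ^ 4 + 1) ^ S.nDeg m

/-- The bound for the entries of the Siegel system: `l1B · d⁷ (dH₀)^n`. [folklore] -/
def Bsieg : ℝ := S.l1B m * ((S.d : ℝ) ^ 7 * (S.d * S.H₀) ^ S.nDeg m)

/-- Siegel's bound for the coefficients of the `pp_l`: `#Λ · A₀ · Bsieg`. [folklore] -/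
def CfB : ℝ := (Fintype.card (S.Λ m) : ℝ) * S.A₀ m * S.Bsieg m

/-- `1 ≤ 26 C_n m⁶` for `m ≥ 1`. [folklore] -/
lemma one_le_base (hm : 1 ≤ m) : (1 : ℝ) ≤ (26 * S.Cn : ℕ) * (m : ℝ) ^ 6 := by
  have h1 : (1 : ℝ) ≤ (26 * S.Cn : ℕ) := by exact_mod_cast (by have := S.one_le_Cn; omega)
  have h2 : (1 : ℝ) ≤ (m : ℝ) ^ 6 := one_le_pow₀ (by exact_mod_cast hm)
  nlinarith

/-- **The `ℓ¹`-norm of the value polynomials**: `l1 (V t n l) ≤ l1B` for `t < T`,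
`n₁, n₂ < K₂ m⁴`, `m ≥ 1`. [folklore] -/
theorem l1_Vl_le (hm : 1 ≤ m) {t : ℕ} (ht : t < S.T m) {n : ℕ × ℕ} (hn1 : n.1 < S.K2 * m ^ 4)
    (hn2 : n.2 < S.K2 * m ^ 4) (l : S.Λ m) : l1 (V t n l) ≤ S.l1B m := by
  refine (l1_V_le t n l).trans ?_
  have hi : (l.1 : ℕ) < S.Ca * m ^ 6 := l.1.2
  have hj : (l.2.1 : ℕ) < m ^ 2 := l.2.1.2
  have hk : (l.2.2 : ℕ) < m ^ 6 := l.2.2.2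
  have hT : t < S.K₁ * m ^ 6 := ht
  have hm6 : m ^ 2 ≤ m ^ 6 := Nat.pow_le_pow_right hm (by norm_num)
  -- the exponent `i + k + t ≤ n`
  have hn : S.nDeg m = 2 * (S.K2 * m ^ 6) + S.Ca * m ^ 6 + m ^ 6 + S.K₁ * m ^ 6 := by
    unfold nDeg Cn; ring
  have hexp : (l.1 : ℕ) + (l.2.2 : ℕ) + t ≤ S.nDeg m := by rw [hn]; omega
  -- the base `25 (i + k + t) + j ≤ 26 C_n m⁶`
  have hCn1 := S.one_le_Cn
  have hjm : (l.2.1 : ℕ) ≤ S.Cn * m ^ 6 :=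
    calc (l.2.1 : ℕ) ≤ m ^ 6 := by omega
      _ = 1 * m ^ 6 := (one_mul _).symm
      _ ≤ S.Cn * m ^ 6 := Nat.mul_le_mul_right _ hCn1
  have hikt : (l.1 : ℕ) + (l.2.2 : ℕ) + t ≤ S.Cn * m ^ 6 := by
    have : S.Cn * m ^ 6 = S.nDeg m := rfl
    rw [this]; exact hexp
  have h1 : 25 * ((l.1 : ℕ) + (l.2.2 : ℕ) + t) + (l.2.1 : ℕ) ≤ 26 * (S.Cn * m ^ 6) := by omega
  have hbase : 25 * (((l.1 : ℕ) : ℝ) + (l.2.2 : ℕ) + t) + (l.2.1 : ℕ) ≤ (26 * S.Cn : ℕ) * (m : ℝ) ^ 6 := by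
    have h1' : ((25 * ((l.1 : ℕ) + (l.2.2 : ℕ) + t) + (l.2.1 : ℕ) : ℕ) : ℝ) ≤
        ((26 * (S.Cn * m ^ 6) : ℕ) : ℝ) := by exact_mod_cast h1
    have e1 : ((25 * ((l.1 : ℕ) + (l.2.2 : ℕ) + t) + (l.2.1 : ℕ) : ℕ) : ℝ) =
        25 * (((l.1 : ℕ) : ℝ) + (l.2.2 : ℕ) + t) + (l.2.1 : ℕ) := by push_cast; ring
    have e2 : ((26 * (S.Cn * m ^ 6) : ℕ) : ℝ) = (26 * S.Cn : ℕ) * (m : ℝ) ^ 6 := by push_cast; ring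
    rw [e1, e2] at h1'
    exact h1'
  have hbase0 : 0 ≤ 25 * (((l.1 : ℕ) : ℝ) + (l.2.2 : ℕ) + t) + (l.2.1 : ℕ) := by positivity
  have hB1 := S.one_le_base m hm
  -- the second base `n₁ + n₂ + 1 ≤ 2 K₂ m⁴ + 1`
  have hbase2 : (n.1 : ℝ) + n.2 + 1 ≤ (2 * S.K2 : ℕ) * (m : ℝ) ^ 4 + 1 := by
    have h' : n.1 + n.2 + 1 ≤ 2 * (S.K2 * m ^ 4) + 1 := by omega
    have h'' : ((n.1 + n.2 + 1 : ℕ) : ℝ) ≤ ((2 * (S.K2 * m ^ 4) + 1 : ℕ) : ℝ) := by exact_mod_cast h'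
    have e1 : ((n.1 + n.2 + 1 : ℕ) : ℝ) = (n.1 : ℝ) + n.2 + 1 := by push_cast; ring
    have e2 : ((2 * (S.K2 * m ^ 4) + 1 : ℕ) : ℝ) = (2 * S.K2 : ℕ) * (m : ℝ) ^ 4 + 1 := by push_cast; ring
    rw [e1, e2] at h''
    exact h''
  have hbase20 : (1 : ℝ) ≤ (n.1 : ℝ) + n.2 + 1 := by
    linarith [(Nat.cast_nonneg n.1 : (0 : ℝ) ≤ n.1), (Nat.cast_nonneg n.2 : (0 : ℝ) ≤ n.2)]
  unfold l1B
  refine mul_le_mul ?_ ?_ (by positivity) (by positivity)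
  · calc (25 * (((l.1 : ℕ) : ℝ) + (l.2.2 : ℕ) + t) + (l.2.1 : ℕ)) ^ t
        ≤ ((26 * S.Cn : ℕ) * (m : ℝ) ^ 6) ^ t := pow_le_pow_left₀ hbase0 hbase t
      _ ≤ ((26 * S.Cn : ℕ) * (m : ℝ) ^ 6) ^ S.T m := pow_le_pow_right₀ hB1 ht.le
  · calc ((n.1 : ℝ) + n.2 + 1) ^ ((l.1 : ℕ) + (l.2.2 : ℕ) + t)
        ≤ ((2 * S.K2 : ℕ) * (m : ℝ) ^ 4 + 1) ^ ((l.1 : ℕ) + (l.2.2 : ℕ) + t) :=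
          pow_le_pow_left₀ (by positivity) hbase2 _
      _ ≤ ((2 * S.K2 : ℕ) * (m : ℝ) ^ 4 + 1) ^ S.nDeg m :=
          pow_le_pow_right₀ (hbase20.trans hbase2) hexp

/-- `1 ≤ l1B` (`m ≥ 1`). [folklore] -/
lemma one_le_l1B (hm : 1 ≤ m) : 1 ≤ S.l1B m := by
  unfold l1B
  have h1 := S.one_le_base m hm
  have h2 : (1 : ℝ) ≤ (2 * S.K2 : ℕ) * (m : ℝ) ^ 4 + 1 := by
    have : (0 : ℝ) ≤ (2 * S.K2 : ℕ) * (m : ℝ) ^ 4 := by positivity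
    linarith
  exact one_le_mul_of_one_le_of_one_le (one_le_pow₀ h1) (one_le_pow₀ h2)

/-- `1 ≤ Bsieg` (`m ≥ 1`). [folklore] -/
lemma one_le_Bsieg (hm : 1 ≤ m) : 1 ≤ S.Bsieg m := by
  unfold Bsieg
  have h1 := S.one_le_l1B m hm
  have hd : (1 : ℝ) ≤ S.d := by exact_mod_cast S.one_le_d
  have hdH : (1 : ℝ) ≤ S.d * S.H₀ := by nlinarith [S.one_le_H₀]
  exact one_le_mul_of_one_le_of_one_le h1
    (one_le_mul_of_one_le_of_one_le (one_le_pow₀ hd) (one_le_pow₀ hdH))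

/-- Degrees of the entries of the Siegel system: `≤ n δ₀`. [folklore] -/
theorem natDegree_homEval_Vl_le {t : ℕ} (ht : t < S.T m) {n : ℕ × ℕ} (hn1 : n.1 ≤ S.K2 * m ^ 4)
    (hn2 : n.2 ≤ S.K2 * m ^ 4) (l : S.Λ m) (i₁ i₂ : Fin S.E.d) :
    (homEval S.E.N S.E.b (S.nDeg m) (MvPolynomial.map (Polynomial.C : ℤ →+* ℤ[X])
      (V t n l)) i₁ i₂).natDegree ≤ S.nDeg m * S.δ₀ := by
  have h := natDegree_homEval_entry_le (δP := 0)
    (P := MvPolynomial.map (Polynomial.C : ℤ →+* ℤ[X]) (V t n l)) S.natDegree_N_le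
    S.natDegree_b_le
    (fun α hα => S.degree_le_of_mem_support_Vl m ht hn1 hn2 l (support_map_subset _ _ hα))
    (fun α => by rw [MvPolynomial.coeff_map, Polynomial.natDegree_C]) i₁ i₂
  simpa using h

/-- Heights of the entries of the Siegel system: `zl1 ≤ Bsieg`. [folklore] -/
theorem zl1_homEval_Vl_le (hm : 1 ≤ m) {t : ℕ} (ht : t < S.T m) {n : ℕ × ℕ}
    (hn1 : n.1 < S.K2 * m ^ 4) (hn2 : n.2 < S.K2 * m ^ 4) (l : S.Λ m) (i₁ i₂ : Fin S.E.d) :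
    zl1 (homEval S.E.N S.E.b (S.nDeg m) (MvPolynomial.map (Polynomial.C : ℤ →+* ℤ[X])
      (V t n l)) i₁ i₂) ≤ S.Bsieg m := by
  have h := seminorm_homEval_entry_le zl1 zl1_one.le S.one_le_H₀ S.zl1_N_le S.zl1_b_le
    (P := MvPolynomial.map (Polynomial.C : ℤ →+* ℤ[X]) (V t n l))
    (fun α hα => S.degree_le_of_mem_support_Vl m ht hn1.le hn2.le l (support_map_subset _ _ hα)) i₁ i₂
  refine h.trans ?_
  unfold Bsieg
  have hw : wnorm zl1 (MvPolynomial.map (Polynomial.C : ℤ →+* ℤ[X]) (V t n l)) ≤ S.l1B m :=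
    (wnorm_map_le _ _ _ (fun z => by rw [zl1_C, normRingSeminorm_int_apply]) _).trans
      (S.l1_Vl_le m hm ht hn1 hn2 l)
  have hH := S.H₀_nonneg
  have hE : S.E.d = S.d := rfl
  rw [hE]
  exact mul_le_mul_of_nonneg_right hw (by positivity)

end Bounds

/-! ### Siegel's step -/

section Siegel

variable (m : ℕ)

/-- **Siegel's step**: there are `pp_l ∈ ℤ[T]`, not all zero, of degree `< A₀` and coefficients
`≤ CfB`, such that the representing matrices of the mixed polynomials vanish for all `t < T` and
all `n ∈ [0, m⁴)²` (`m ≥ 1`). [cite: Chudnovsky1984, Ch. 7 §2 p. 307] -/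
theorem siegel_step (hm : 1 ≤ m) :
    ∃ pp : S.Λ m → ℤ[X], pp ≠ 0 ∧ (∀ l, (pp l).natDegree < S.A₀ m) ∧
      (∀ l k, |((pp l).coeff k : ℝ)| ≤ S.CfB m) ∧
      ∀ t < S.T m, ∀ (n₁ n₂ : Fin (m ^ 4)),
        homEval S.E.N S.E.b (S.nDeg m) (S.Pmix m pp t ((n₁ : ℕ), (n₂ : ℕ))) = 0 := by
  classical
  have hd1 := S.one_le_d
  have hK2 := S.one_le_K2
  have hm4 : m ^ 4 ≤ S.K2 * m ^ 4 := by
    calc m ^ 4 = 1 * m ^ 4 := (one_mul _).symm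
      _ ≤ S.K2 * m ^ 4 := Nat.mul_le_mul_right _ hK2
  -- the system
  let ι := (Fin (S.T m) × (Fin (m ^ 4) × Fin (m ^ 4))) × (Fin S.E.d × Fin S.E.d)
  let W : ι → S.Λ m → ℤ[X] := fun e l =>
    homEval S.E.N S.E.b (S.nDeg m) (MvPolynomial.map (Polynomial.C : ℤ →+* ℤ[X])
      (V e.1.1 ((e.1.2.1 : ℕ), (e.1.2.2 : ℕ)) l)) e.2.1 e.2.2
  have ht : ∀ e : ι, (e.1.1 : ℕ) < S.T m := fun e => e.1.1.2
  have hn1 : ∀ e : ι, ((e.1.2.1 : ℕ), (e.1.2.2 : ℕ)).1 < S.K2 * m ^ 4 := fun e =>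
    lt_of_lt_of_le e.1.2.1.2 hm4
  have hn2 : ∀ e : ι, ((e.1.2.1 : ℕ), (e.1.2.2 : ℕ)).2 < S.K2 * m ^ 4 := fun e =>
    lt_of_lt_of_le e.1.2.2.2 hm4
  have hWδ : ∀ e l, (W e l).natDegree ≤ S.nDeg m * S.δ₀ := fun e l =>
    S.natDegree_homEval_Vl_le m (ht e) (hn1 e).le (hn2 e).le l _ _
  have hWB : ∀ e l k, |((W e l).coeff k : ℝ)| ≤ S.Bsieg m := fun e l k =>
    (abs_coeff_le_zl1 _ _).trans (S.zl1_homEval_Vl_le m hm (ht e) (hn1 e) (hn2 e) l _ _)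
  have hT0 : 0 < S.T m := by
    unfold T; have := S.one_le_K₁; positivity
  have hι : 0 < Fintype.card ι := by
    simp only [ι, Fintype.card_prod, Fintype.card_fin]
    have : 0 < S.E.d := S.E.d_pos
    have : 0 < m := by omega
    positivity
  have hA : 0 < S.A₀ m := Nat.succ_pos _
  have hcard : 2 * (Fintype.card ι * (S.A₀ m + S.nDeg m * S.δ₀)) ≤
      Fintype.card (S.Λ m) * S.A₀ m := by
    simp only [ι, Fintype.card_prod, Fintype.card_fin]
    have hE : S.E.d = S.d := rfl
    rw [hE]
    have key : S.La m * (L0 m * L1 m) * S.A₀ m =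
        2 * (S.T m * (m ^ 4 * m ^ 4) * (S.d * S.d) * (S.A₀ m + S.nDeg m * S.δ₀)) +
          2 * (S.K₁ * S.d ^ 2 * m ^ 14) := by
      unfold A₀ T La L0 L1 Ca
      ring
    rw [key]
    exact Nat.le_add_right _ _
  obtain ⟨pp, hpp0, hppdeg, hppB, hppeq⟩ :=
    siegel_poly W (S.nDeg m * S.δ₀) (S.A₀ m) (S.Bsieg m) hWδ hWB (S.one_le_Bsieg m hm) hι hA hcard
  refine ⟨pp, hpp0, hppdeg, fun l k => (hppB l k).trans (le_of_eq (by unfold CfB; ring)), ?_⟩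
  intro t htT n₁ n₂
  refine Matrix.ext fun i₁ i₂ => ?_
  have h := hppeq ((⟨t, htT⟩, (n₁, n₂)), (i₁, i₂))
  rw [homEval_Pmix, Matrix.sum_apply]
  simpa [W, Matrix.smul_apply] using h

/-- The vanishing of the representing matrix forces `F_p^{(t)}(z_n) = 0`. [folklore] -/
theorem iteratedDeriv_F_eq_zero (pp : S.Λ m → ℤ[X]) {t : ℕ} (ht : t < S.T m) {n : ℕ × ℕ}
    (hn1 : n.1 ≤ S.K2 * m ^ 4) (hn2 : n.2 ≤ S.K2 * m ^ 4)
    (h0 : homEval S.E.N S.E.b (S.nDeg m) (S.Pmix m pp t n) = 0) :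
    iteratedDeriv t (F S.L S.c (fun l => Polynomial.aeval S.θ (pp l))) (zpt S.L n) = 0 := by
  have h := S.E.evC_eq_zero_of_homEval_eq_zero
    (fun α hα => S.degree_le_of_mem_support_Pmix m pp ht hn1 hn2 hα) h0
  rwa [S.evC_Pmix m pp t n] at h

end Siegel

/-! ### The extrapolation -/

section Extrapolation

variable (m : ℕ)

/-- The vanishing hypothesis at step `k`: `F_p^{(t)}(z_n) = 0` for all `t < T_k` and all
`n ∈ [0, X_k)²`. [folklore] -/
def Hvan (p : S.Λ m → ℂ) (k : ℕ) : Prop :=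
  ∀ n : ℕ × ℕ, n.1 < Xk m k → n.2 < Xk m k → ∀ t < S.Tk m k,
    iteratedDeriv t (F S.L S.c p) (zpt S.L n) = 0

/-- `(1/2)^N ≤ exp(-N/2)`. [folklore] -/
lemma half_pow_le_exp_neg (N : ℕ) : (1 / 2 : ℝ) ^ N ≤ Real.exp (-(N : ℝ) / 2) := by
  have h2 : (1 / 2 : ℝ) ≤ Real.exp (-(1 / 2 : ℝ)) := by
    have := Real.add_one_le_exp (-(1 / 2 : ℝ))
    linarith
  calc (1 / 2 : ℝ) ^ N ≤ Real.exp (-(1 / 2 : ℝ)) ^ N := pow_le_pow_left₀ (by norm_num) h2 N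
    _ = Real.exp (-(N : ℝ) / 2) := by rw [← Real.exp_nat_mul]; ring_nf

/-- **The exponent at step `k`**: `C_F L1 X_k² - T_k X_k²/2 ≤ -K₂ m¹⁴` for `k ≤ k_max`
(`X_k = 2^k m⁴`, `T_k = C'' 2^{k_max-k} m⁶`, `C'' ≥ 2C_F + 2`). [folklore] -/
theorem stage_exponent_le {k : ℕ} (hk : k ≤ S.kmax) :
    S.CF * (L1 m * (Xk m k : ℝ) ^ 2) - (S.Tk m k * (Xk m k : ℝ) ^ 2) / 2 ≤
      -((S.K2 : ℝ) * (m : ℝ) ^ 14) := by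
  have hCF := S.CF_nonneg
  have hCpp := S.two_mul_CF_add_two_le
  -- write everything in terms of `u = 2^k`, `v = 2^(kmax - k)`, `M = m`
  set u : ℝ := (2 : ℝ) ^ k with hu
  set v : ℝ := (2 : ℝ) ^ (S.kmax - k) with hv
  have huv : u * v = S.K2 := by
    rw [hu, hv, ← pow_add, Nat.add_sub_cancel' hk]; unfold K2; push_cast; ring
  have hu1 : 1 ≤ u := one_le_pow₀ (by norm_num)
  have hv1 : 1 ≤ v := one_le_pow₀ (by norm_num)
  have hX : (Xk m k : ℝ) = u * (m : ℝ) ^ 4 := by unfold Xk; push_cast; rw [hu]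
  have hT : (S.Tk m k : ℝ) = S.Cpp * v * (m : ℝ) ^ 6 := by unfold Tk; push_cast; rw [hv]
  have hL : (L1 m : ℝ) = (m : ℝ) ^ 6 := by unfold L1; push_cast; ring
  rw [hX, hT, hL]
  have hm0 : (0 : ℝ) ≤ (m : ℝ) ^ 14 := by positivity
  have hK2 : (S.K2 : ℝ) = u * v := huv.symm
  rw [hK2]
  -- `C_F u² m¹⁴ - C'' v u² m¹⁴ / 2 ≤ -u v m¹⁴` since `u ≤ u v`... use `u² ≤ u (u v)`:
  have h1 : (m : ℝ) ^ 6 * (u * (m : ℝ) ^ 4) ^ 2 = u ^ 2 * (m : ℝ) ^ 14 := by ring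
  have h2 : S.Cpp * v * (m : ℝ) ^ 6 * (u * (m : ℝ) ^ 4) ^ 2 = S.Cpp * v * u ^ 2 * (m : ℝ) ^ 14 := by ring
  rw [h1, h2]
  have hu0 : 0 ≤ u := by linarith
  have huu : u ≤ u * u := by nlinarith
  have key : S.CF * (u ^ 2 * (m : ℝ) ^ 14) - S.Cpp * v * u ^ 2 * (m : ℝ) ^ 14 / 2 + u * v * (m : ℝ) ^ 14 =
      (u * (m : ℝ) ^ 14) * (S.CF * u - S.Cpp * v * u / 2 + v) := by ring
  have hneg : S.CF * u - S.Cpp * v * u / 2 + v ≤ 0 := by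
    -- `C'' v u / 2 ≥ (C_F + 1) v u ≥ C_F u + v`
    have hvu0 : 0 ≤ v * u := by positivity
    have h3 : (S.CF + 1) * (v * u) ≤ S.Cpp * v * u / 2 := by
      have := mul_le_mul_of_nonneg_right hCpp hvu0
      nlinarith
    have h4 : S.CF * u ≤ S.CF * (v * u) :=
      mul_le_mul_of_nonneg_left (le_mul_of_one_le_left hu0 hv1) hCF
    have h5 : v ≤ v * u := le_mul_of_one_le_right (by linarith) hu1
    nlinarith
  have : (u * (m : ℝ) ^ 14) * (S.CF * u - S.Cpp * v * u / 2 + v) ≤ 0 :=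
    mul_nonpos_of_nonneg_of_nonpos (by positivity) hneg
  linarith

/-- The small bound for the derivatives at level `m`: `jetB m C_p =
C_p · #Λ · T! · exp(C_F (T + La K₂m⁴ + L0 K₂m⁴)) · exp(-K₂ m¹⁴)`. [folklore] -/
def jetB (Cp : ℝ) : ℝ :=
  Cp * Fintype.card (S.Λ m) * (S.T m)! *
    Real.exp (S.CF * (S.T m + S.La m * (S.K2 * m ^ 4) + L0 m * (S.K2 * m ^ 4))) *
      Real.exp (-((S.K2 : ℝ) * (m : ℝ) ^ 14))

/-- `0 ≤ jetB` for `C_p ≥ 0`. [folklore] -/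
lemma jetB_nonneg {Cp : ℝ} (hCp : 0 ≤ Cp) : 0 ≤ S.jetB m Cp := by
  unfold jetB; positivity

/-- **One extrapolation step** (analytic part): under `Hvan k` (`k < k_max`, `m ≥ 1`), every
derivative of order `t < T` at a point of the doubled box is bounded by `jetB m C_p`
(`‖p‖ ≤ C_p`). [cite: Chudnovsky1984, Ch. 7 Thm 4.1 p. 318] -/
theorem norm_le_jetB_of_Hvan (hm : 1 ≤ m) {p : S.Λ m → ℂ} {Cp : ℝ} (hCp : ‖p‖ ≤ Cp) {k : ℕ}
    (hk : k < S.kmax) (hH : S.Hvan m p k) {n : ℕ × ℕ} (hn1 : n.1 < Xk m (k + 1))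
    (hn2 : n.2 < Xk m (k + 1)) {t : ℕ} (ht : t < S.T m) :
    ‖iteratedDeriv t (F S.L S.c p) (zpt S.L n)‖ ≤ S.jetB m Cp := by
  have hX1 : 1 ≤ Xk m k := by
    unfold Xk
    exact Nat.one_le_iff_ne_zero.mpr (by positivity)
  rw [Xk_succ] at hn1 hn2
  have h := S.CF_spec (S.La m) (L0 m) (L1 m) (Xk m k) (S.Tk m k) hX1 p hH n hn1 hn2 t
  refine h.trans ?_
  have hCp0 : 0 ≤ Cp := (norm_nonneg _).trans hCp
  have hCF := S.CF_nonneg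
  -- `t! ≤ T!`, `t ≤ T`, `X_k ≤ K₂ m⁴`, and the stage exponent
  have hfact : ((t ! : ℕ) : ℝ) ≤ (S.T m)! := by exact_mod_cast Nat.factorial_le ht.le
  have htT : (t : ℝ) ≤ S.T m := by exact_mod_cast ht.le
  have hXK : (Xk m k : ℝ) ≤ (S.K2 * m ^ 4 : ℕ) := by exact_mod_cast S.Xk_le m hk.le
  have hstage := S.stage_exponent_le m hk.le
  have hhalf := half_pow_le_exp_neg (S.Tk m k * Xk m k ^ 2)
  set Φ₀ : ℝ := S.T m + S.La m * (S.K2 * m ^ 4 : ℕ) + L0 m * (S.K2 * m ^ 4 : ℕ) with hΦ₀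
  have hexp : Real.exp (S.CF * (t + S.La m * Xk m k + L0 m * Xk m k + L1 m * (Xk m k : ℝ) ^ 2)) *
      (1 / 2 : ℝ) ^ (S.Tk m k * Xk m k ^ 2) ≤
      Real.exp (S.CF * Φ₀) * Real.exp (-((S.K2 : ℝ) * (m : ℝ) ^ 14)) := by
    calc Real.exp (S.CF * (t + S.La m * Xk m k + L0 m * Xk m k + L1 m * (Xk m k : ℝ) ^ 2)) *
          (1 / 2 : ℝ) ^ (S.Tk m k * Xk m k ^ 2)
        ≤ Real.exp (S.CF * (t + S.La m * Xk m k + L0 m * Xk m k + L1 m * (Xk m k : ℝ) ^ 2)) *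
          Real.exp (-((S.Tk m k * Xk m k ^ 2 : ℕ) : ℝ) / 2) := by gcongr
      _ = Real.exp (S.CF * (t + S.La m * Xk m k + L0 m * Xk m k) +
          (S.CF * (L1 m * (Xk m k : ℝ) ^ 2) - (S.Tk m k * (Xk m k : ℝ) ^ 2) / 2)) := by
          rw [← Real.exp_add]; push_cast; ring_nf
      _ ≤ Real.exp (S.CF * Φ₀ + -((S.K2 : ℝ) * (m : ℝ) ^ 14)) := by
          refine Real.exp_le_exp.mpr (add_le_add ?_ hstage)
          refine mul_le_mul_of_nonneg_left ?_ hCF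
          rw [hΦ₀]
          have hLa : (0 : ℝ) ≤ S.La m := Nat.cast_nonneg _
          have hL0 : (0 : ℝ) ≤ L0 m := Nat.cast_nonneg _
          nlinarith [mul_le_mul_of_nonneg_left hXK hLa, mul_le_mul_of_nonneg_left hXK hL0]
      _ = _ := by rw [Real.exp_add]
  have hcard : (0 : ℝ) ≤ Fintype.card (Lam (S.La m) (L0 m) (L1 m)) := Nat.cast_nonneg _
  unfold jetB
  calc ‖p‖ * Fintype.card (Lam (S.La m) (L0 m) (L1 m)) * t ! *
        Real.exp (S.CF * (t + S.La m * Xk m k + L0 m * Xk m k + L1 m * (Xk m k : ℝ) ^ 2)) *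
          (1 / 2 : ℝ) ^ (S.Tk m k * Xk m k ^ 2)
      = ‖p‖ * Fintype.card (Lam (S.La m) (L0 m) (L1 m)) * t ! *
        (Real.exp (S.CF * (t + S.La m * Xk m k + L0 m * Xk m k + L1 m * (Xk m k : ℝ) ^ 2)) *
          (1 / 2 : ℝ) ^ (S.Tk m k * Xk m k ^ 2)) := by ring
    _ ≤ Cp * Fintype.card (Lam (S.La m) (L0 m) (L1 m)) * (S.T m)! *
        (Real.exp (S.CF * Φ₀) * Real.exp (-((S.K2 : ℝ) * (m : ℝ) ^ 14))) := by
        gcongr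
    _ = _ := by rw [hΦ₀]; push_cast; ring

/-- The threshold `m₁ = ⌈4 (‖ω₁‖+‖ω₂‖) ‖c‖⌉ + 1` beyond which Tijdeman's count is beaten.
[folklore] -/
def m₁ : ℕ := ⌈4 * (‖S.L.ω₁‖ + ‖S.L.ω₂‖) * ‖S.c‖⌉₊ + 1

/-- **The last step is impossible**: `Hvan k_max` contradicts Tijdeman's lemma (`p ≠ 0`,
`m ≥ m₁`, `m ≥ 1`). [cite: BakerTNT1975, Ch. 12 §2 Lemma 1] -/
theorem not_Hvan_kmax (hm : 1 ≤ m) (hm₁ : S.m₁ ≤ m) {p : S.Λ m → ℂ} (hp : p ≠ 0)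
    (hH : S.Hvan m p S.kmax) : False := by
  have h2L1 := S.two_mul_L1_le_Tk_kmax m
  have hF : ∀ n : ℕ × ℕ, n.1 < Xk m S.kmax → n.2 < Xk m S.kmax → ∀ t < 2 * L1 m,
      iteratedDeriv t (F S.L S.c p) (zpt S.L n) = 0 := fun n hn1 hn2 t ht =>
    hH n hn1 hn2 t (lt_of_lt_of_le ht h2L1)
  have h := two_mul_sq_le_of_vanishing S.L S.c S.hc hp hF
  -- the numbers
  have hX : (Xk m S.kmax : ℝ) = S.K2 * (m : ℝ) ^ 4 := by unfold Xk K2; push_cast; ring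
  have hLa : (S.La m : ℝ) = S.Ca * (m : ℝ) ^ 6 := by unfold La; push_cast; ring
  have hL0 : (L0 m : ℝ) = (m : ℝ) ^ 2 := by unfold L0; push_cast; ring
  have hL1 : (L1 m : ℝ) = (m : ℝ) ^ 6 := by unfold L1; push_cast; ring
  rw [hX, hLa, hL0] at h
  have hCa : (S.Ca : ℝ) = 4 * S.Cpp * S.K2 * (S.d : ℝ) ^ 2 := by unfold Ca K₁; push_cast; ring
  have hK2 : 64 * S.Cpp * (S.d : ℝ) ^ 2 ≤ S.K2 := by exact_mod_cast S.le_K2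
  have hCpp : (2 : ℝ) ≤ S.Cpp := by exact_mod_cast S.two_le_Cpp
  have hd : (1 : ℝ) ≤ S.d := by exact_mod_cast S.one_le_d
  have hm1 : (1 : ℝ) ≤ m := by exact_mod_cast hm
  have hmm : (S.m₁ : ℝ) ≤ m := by exact_mod_cast hm₁
  have hm₁ : 4 * (‖S.L.ω₁‖ + ‖S.L.ω₂‖) * ‖S.c‖ + 1 ≤ (m : ℝ) := by
    have : (⌈4 * (‖S.L.ω₁‖ + ‖S.L.ω₂‖) * ‖S.c‖⌉₊ : ℝ) + 1 = (S.m₁ : ℝ) := by unfold m₁; push_cast; ring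
    linarith [Nat.le_ceil (4 * (‖S.L.ω₁‖ + ‖S.L.ω₂‖) * ‖S.c‖)]
  set w : ℝ := (‖S.L.ω₁‖ + ‖S.L.ω₂‖) * ‖S.c‖ with hw
  have hw0 : 0 ≤ w := by positivity
  rw [hCa] at h
  -- `h : 2 (K₂ m⁴)² ≤ 30 (4 C'' K₂ d² m⁶ m² + (‖ω₁‖+‖ω₂‖) K₂ m⁴ (m² ‖c‖))`
  have hK2pos : (0 : ℝ) < S.K2 := by
    have := S.one_le_K2; exact_mod_cast this
  have hm2 : 4 * w + 1 ≤ (m : ℝ) ^ 2 := by nlinarith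
  -- divide the picture by `K₂ m⁶ > 0`
  have key : (2 * S.K2 - 120 * S.Cpp * (S.d : ℝ) ^ 2) * (m : ℝ) ^ 2 ≤ 30 * w := by
    have hpos : (0 : ℝ) < S.K2 * (m : ℝ) ^ 6 := by positivity
    have h' : 2 * (S.K2 * (m : ℝ) ^ 4) ^ 2 - 30 * (4 * S.Cpp * S.K2 * (S.d : ℝ) ^ 2 * (m : ℝ) ^ 6 * (m : ℝ) ^ 2) ≤
        30 * ((‖S.L.ω₁‖ + ‖S.L.ω₂‖) * (S.K2 * (m : ℝ) ^ 4) * ((m : ℝ) ^ 2 * ‖S.c‖)) := by linarith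
    have hfac : 2 * (S.K2 * (m : ℝ) ^ 4) ^ 2 - 30 * (4 * S.Cpp * S.K2 * (S.d : ℝ) ^ 2 * (m : ℝ) ^ 6 * (m : ℝ) ^ 2) =
        (S.K2 * (m : ℝ) ^ 6) * ((2 * S.K2 - 120 * S.Cpp * (S.d : ℝ) ^ 2) * (m : ℝ) ^ 2) := by ring
    have hfac2 : 30 * ((‖S.L.ω₁‖ + ‖S.L.ω₂‖) * (S.K2 * (m : ℝ) ^ 4) * ((m : ℝ) ^ 2 * ‖S.c‖)) =
        (S.K2 * (m : ℝ) ^ 6) * (30 * w) := by rw [hw]; ring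
    rw [hfac, hfac2] at h'
    exact le_of_mul_le_mul_left h' hpos
  have h8 : (8 : ℝ) ≤ 2 * S.K2 - 120 * S.Cpp * (S.d : ℝ) ^ 2 := by
    have : (1 : ℝ) ≤ S.Cpp * (S.d : ℝ) ^ 2 := by nlinarith
    nlinarith
  have : 8 * (4 * w + 1) ≤ 30 * w := by
    calc 8 * (4 * w + 1) ≤ 8 * (m : ℝ) ^ 2 := by nlinarith
      _ ≤ (2 * S.K2 - 120 * S.Cpp * (S.d : ℝ) ^ 2) * (m : ℝ) ^ 2 := by nlinarith
      _ ≤ 30 * w := key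
  linarith

/-- **The extrapolation** (the substitute for the zero estimate): under `Hvan 0` (`p ≠ 0`,
`‖p‖ ≤ C_p`, `m ≥ max(1, m₁)`) there is a nonzero derivative `F_p^{(t)}(z_n)`, `t < T`,
`n ∈ [0, K₂m⁴)²`, bounded by `jetB m C_p`. [cite: Chudnovsky1984, Ch. 7 Thm 4.1 p. 318] -/
theorem exists_small_value (hm : 1 ≤ m) (hm₁ : S.m₁ ≤ m) {p : S.Λ m → ℂ} (hp : p ≠ 0) {Cp : ℝ}
    (hCp : ‖p‖ ≤ Cp) (h0 : S.Hvan m p 0) :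
    ∃ (n : ℕ × ℕ) (t : ℕ), n.1 < S.K2 * m ^ 4 ∧ n.2 < S.K2 * m ^ 4 ∧ t < S.T m ∧
      iteratedDeriv t (F S.L S.c p) (zpt S.L n) ≠ 0 ∧
      ‖iteratedDeriv t (F S.L S.c p) (zpt S.L n)‖ ≤ S.jetB m Cp := by
  classical
  -- reverse induction on the step
  suffices hind : ∀ j : ℕ, j ≤ S.kmax → S.Hvan m p (S.kmax - j) →
      ∃ (n : ℕ × ℕ) (t : ℕ), n.1 < S.K2 * m ^ 4 ∧ n.2 < S.K2 * m ^ 4 ∧ t < S.T m ∧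
        iteratedDeriv t (F S.L S.c p) (zpt S.L n) ≠ 0 ∧
        ‖iteratedDeriv t (F S.L S.c p) (zpt S.L n)‖ ≤ S.jetB m Cp by
    have := hind S.kmax le_rfl
    rw [Nat.sub_self] at this
    exact this h0
  intro j
  induction j with
  | zero =>
    intro _ hH
    rw [Nat.sub_zero] at hH
    exact (S.not_Hvan_kmax m hm hm₁ hp hH).elim
  | succ j ih =>
    intro hj hH
    set k := S.kmax - (j + 1) with hk
    have hklt : k < S.kmax := by omega
    have hk1 : k + 1 = S.kmax - j := by omega
    by_cases hall : S.Hvan m p (k + 1)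
    · rw [hk1] at hall
      exact ih (by omega) hall
    · -- a nonvanishing derivative in the range of step `k + 1`
      unfold Hvan at hall
      push Not at hall
      obtain ⟨n, hn1, hn2, t, ht, hne⟩ := hall
      have htT : t < S.T m := lt_of_lt_of_le ht (S.Tk_le m (k + 1))
      have hXle : Xk m (k + 1) ≤ S.K2 * m ^ 4 := S.Xk_le m (by omega)
      exact ⟨n, t, lt_of_lt_of_le hn1 hXle, lt_of_lt_of_le hn2 hXle, htT, hne,
        S.norm_le_jetB_of_Hvan m hm hCp hklt hH hn1 hn2 htT⟩

end Extrapolation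

/-! ### The norm polynomial -/

section Norm

variable (m : ℕ) (pp : S.Λ m → ℤ[X]) (t : ℕ) (n : ℕ × ℕ)

/-- `Q(θ) ≠ 0` as soon as `F^{(t)}(z_n) ≠ 0` (the norm of a nonzero element). [folklore] -/
theorem aeval_det_ne_zero (ht : t < S.T m) (hn1 : n.1 ≤ S.K2 * m ^ 4) (hn2 : n.2 ≤ S.K2 * m ^ 4)
    (hξ : iteratedDeriv t (F S.L S.c (fun l => Polynomial.aeval S.θ (pp l))) (zpt S.L n) ≠ 0) :
    Polynomial.aeval S.θ (homEval S.E.N S.E.b (S.nDeg m) (S.Pmix m pp t n)).det ≠ 0 := by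
  refine S.E.det_ne (S.nDeg m) _ (fun α hα => S.degree_le_of_mem_support_Pmix m pp ht hn1 hn2 hα) ?_
  rw [S.evC_Pmix m pp t n]
  exact hξ

/-- Degrees of the coefficients of `Pmix`: `≤ max deg pp_l`. [folklore] -/
theorem natDegree_coeff_Pmix_le {A : ℕ} (hdeg : ∀ l, (pp l).natDegree < A) (α : Fin 7 →₀ ℕ) :
    ((S.Pmix m pp t n).coeff α).natDegree ≤ A := by
  rw [coeff_Pmix]
  refine Polynomial.natDegree_sum_le_of_forall_le _ _ fun l _ => ?_
  refine Polynomial.natDegree_mul_le.trans ?_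
  rw [Polynomial.natDegree_C, add_zero]
  exact (hdeg l).le

/-- Height of `Pmix`: `wnorm ≤ ∑_l zl1(pp_l) · l1(V_l)`. [folklore] -/
theorem wnorm_Pmix_le :
    wnorm zl1 (S.Pmix m pp t n) ≤ ∑ l, zl1 (pp l) * l1 (V t n l) := by
  unfold Pmix
  refine (wnorm_sum_le _ _ _).trans (Finset.sum_le_sum fun l _ => ?_)
  refine (wnorm_mul_le _ _ _).trans ?_
  rw [wnorm_C]
  refine mul_le_mul_of_nonneg_left ?_ (apply_nonneg _ _)
  exact wnorm_map_le _ _ _ (fun z => by rw [zl1_C, normRingSeminorm_int_apply]) _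

/-- **Degree of `Q`**: `≤ d (A + n δ₀)`. [folklore] -/
theorem natDegree_det_le {A : ℕ} (hdeg : ∀ l, (pp l).natDegree < A) (ht : t < S.T m)
    (hn1 : n.1 ≤ S.K2 * m ^ 4) (hn2 : n.2 ≤ S.K2 * m ^ 4) :
    (homEval S.E.N S.E.b (S.nDeg m) (S.Pmix m pp t n)).det.natDegree ≤
      S.E.d * (A + S.nDeg m * S.δ₀) :=
  natDegree_det_le_of_entry fun i j => natDegree_homEval_entry_le S.natDegree_N_le S.natDegree_b_le
    (fun _ hα => S.degree_le_of_mem_support_Pmix m pp ht hn1 hn2 hα)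
    (S.natDegree_coeff_Pmix_le m pp t n hdeg) i j

/-- **Entries of `Y = homEval N b n (Pmix pp t n)`**: `zl1 ≤ #Λ (A C_f) l1B · d⁷ (dH₀)^n`
(`deg pp_l < A`, `|coeff pp_l| ≤ C_f`). [folklore] -/
theorem zl1_entry_le (hm : 1 ≤ m) {A : ℕ} {Cf : ℝ} (hCf : 0 ≤ Cf) (hdeg : ∀ l, (pp l).natDegree < A)
    (hcoeff : ∀ l k, |((pp l).coeff k : ℝ)| ≤ Cf) (ht : t < S.T m) (hn1 : n.1 < S.K2 * m ^ 4)
    (hn2 : n.2 < S.K2 * m ^ 4) (i j : Fin S.E.d) :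
    zl1 (homEval S.E.N S.E.b (S.nDeg m) (S.Pmix m pp t n) i j) ≤
      (Fintype.card (S.Λ m) : ℝ) * (A * Cf) * S.l1B m * ((S.d : ℝ) ^ 7 * (S.d * S.H₀) ^ S.nDeg m) := by
  have hsupp : ∀ α ∈ (S.Pmix m pp t n).support, α.degree ≤ S.nDeg m := fun α hα =>
    S.degree_le_of_mem_support_Pmix m pp ht hn1.le hn2.le hα
  refine (seminorm_homEval_entry_le zl1 zl1_one.le S.one_le_H₀ S.zl1_N_le S.zl1_b_le hsupp
    i j).trans ?_
  have hH := S.H₀_nonneg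
  have hE : S.E.d = S.d := rfl
  rw [hE]
  refine mul_le_mul_of_nonneg_right ?_ (by positivity)
  refine (S.wnorm_Pmix_le m pp t n).trans ?_
  have hterm : ∀ l : S.Λ m, zl1 (pp l) * l1 (V t n l) ≤ (A * Cf) * S.l1B m := by
    intro l
    have h1 : zl1 (pp l) ≤ A * Cf := by
      refine (zl1_le_of_coeff_le _ (hcoeff l)).trans ?_
      gcongr
      exact_mod_cast hdeg l
    exact mul_le_mul h1 (S.l1_Vl_le m hm ht hn1 hn2 l) (wnorm_nonneg _ _) (by positivity)
  calc ∑ l, zl1 (pp l) * l1 (V t n l) ≤ ∑ _l : S.Λ m, (A * Cf) * S.l1B m :=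
        Finset.sum_le_sum fun l _ => hterm l
    _ = (Fintype.card (S.Λ m) : ℝ) * (A * Cf) * S.l1B m := by
        rw [Finset.sum_const, Finset.card_univ, nsmul_eq_mul]; ring

/-- **The lower-bound side**: `|Q(θ)| ≤ |b(θ)^n F^{(t)}(z_n)| · d (1 + d R)^d`, `R` bounding the
entries of `Y(θ)`. [cite: Chudnovsky1984, Ch. 7 §2 p. 307] -/
theorem norm_aeval_det_le {HY : ℝ} {δY : ℕ} (hHY : 0 ≤ HY)
    (hY : ∀ i j, zl1 (homEval S.E.N S.E.b (S.nDeg m) (S.Pmix m pp t n) i j) ≤ HY)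
    (hYδ : ∀ i j, (homEval S.E.N S.E.b (S.nDeg m) (S.Pmix m pp t n) i j).natDegree ≤ δY)
    (ht : t < S.T m) (hn1 : n.1 ≤ S.K2 * m ^ 4) (hn2 : n.2 ≤ S.K2 * m ^ 4) :
    ‖Polynomial.aeval S.θ (homEval S.E.N S.E.b (S.nDeg m) (S.Pmix m pp t n)).det‖ ≤
      ‖Polynomial.aeval S.θ S.E.b ^ S.nDeg m *
          iteratedDeriv t (F S.L S.c (fun l => Polynomial.aeval S.θ (pp l))) (zpt S.L n)‖ *
        (S.E.d * (1 + S.E.d * (HY * max 1 ‖S.θ‖ ^ δY)) ^ S.E.d) := by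
  set Y := homEval S.E.N S.E.b (S.nDeg m) (S.Pmix m pp t n) with hYdef
  have hsupp : ∀ α ∈ (S.Pmix m pp t n).support, α.degree ≤ S.nDeg m := fun α hα =>
    S.degree_le_of_mem_support_Pmix m pp ht hn1 hn2 hα
  have heig := S.E.vecMul_homEval hsupp
  rw [S.evC_Pmix m pp t n] at heig
  have hmap : Polynomial.aeval S.θ Y.det = (Y.map (Polynomial.aeval S.θ : ℤ[X] →ₐ[ℤ] ℂ)).det := by
    rw [show (Polynomial.aeval S.θ : ℤ[X] →ₐ[ℤ] ℂ) Y.det =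
      (Polynomial.aeval S.θ : ℤ[X] →ₐ[ℤ] ℂ).toRingHom Y.det from rfl, RingHom.map_det]
    rfl
  rw [hmap]
  refine norm_det_le_of_vecMul _ S.E.β_ne heig fun i j => ?_
  rw [Matrix.map_apply]
  refine (norm_aeval_le_zl1 (Y i j) S.θ).trans ?_
  exact mul_le_mul (hY i j) (pow_le_pow_right₀ (le_max_left _ _) (hYδ i j)) (by positivity) hHY

end Norm

/-! ### The level-`m` construction assembled -/

section Level

variable (m : ℕ)

/-- The bound `C_p = A₀ · CfB · max(1,|θ|)^{A₀}` for the coefficients `pp_l(θ)`. [folklore] -/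
def Cp : ℝ := S.A₀ m * S.CfB m * max 1 ‖S.θ‖ ^ S.A₀ m

/-- The bound `H_Y = #Λ (A₀ CfB) l1B d⁷(dH₀)^n` for the entries of the representing matrix.
[folklore] -/
def HY : ℝ :=
  (Fintype.card (S.Λ m) : ℝ) * (S.A₀ m * S.CfB m) * S.l1B m *
    ((S.d : ℝ) ^ 7 * (S.d * S.H₀) ^ S.nDeg m)

/-- The bound for `|Q(θ)|` at level `m`:
`|b(θ)|^n · jetB m C_p · d (1 + d H_Y max(1,|θ|)^{A₀ + nδ₀})^d`. [folklore] -/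
def valB : ℝ :=
  ‖Polynomial.aeval S.θ S.E.b‖ ^ S.nDeg m * S.jetB m (S.Cp m) *
    (S.d * (1 + S.d * (S.HY m * max 1 ‖S.θ‖ ^ (S.A₀ m + S.nDeg m * S.δ₀))) ^ S.d)

/-- A transcendental number is not a root of a nonzero integer polynomial. [folklore] -/
theorem aeval_theta_ne_zero {q : ℤ[X]} (hq : q ≠ 0) : Polynomial.aeval S.θ q ≠ 0 := by
  intro h
  apply S.hθ
  refine ⟨q.map (algebraMap ℤ ℚ), ?_, ?_⟩
  · exact (Polynomial.map_ne_zero_iff (algebraMap ℤ ℚ).injective_int).mpr hq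
  · rwa [Polynomial.aeval_map_algebraMap]

/-- The sup norm of `p = pp(θ)` is bounded by `C_p`. [folklore] -/
lemma norm_p_le {pp : S.Λ m → ℤ[X]} (hppdeg : ∀ l, (pp l).natDegree < S.A₀ m)
    (hppB : ∀ l k, |((pp l).coeff k : ℝ)| ≤ S.CfB m) (hCfB0 : 0 ≤ S.CfB m) :
    ‖(fun l => Polynomial.aeval S.θ (pp l) : S.Λ m → ℂ)‖ ≤ S.Cp m := by
  have hΘθ : 1 ≤ max 1 ‖S.θ‖ := le_max_left _ _
  have hCp0 : 0 ≤ S.Cp m := by unfold Cp; positivity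
  refine (pi_norm_le_iff_of_nonneg hCp0).mpr fun l => ?_
  refine (norm_aeval_le_zl1 (pp l) S.θ).trans ?_
  have h1 : zl1 (pp l) ≤ ((pp l).natDegree + 1) * S.CfB m := zl1_le_of_coeff_le _ (hppB l)
  have h2 : ((pp l).natDegree : ℝ) + 1 ≤ S.A₀ m := by exact_mod_cast hppdeg l
  have h3 : max 1 ‖S.θ‖ ^ (pp l).natDegree ≤ max 1 ‖S.θ‖ ^ S.A₀ m :=
    pow_le_pow_right₀ hΘθ (hppdeg l).le
  unfold Cp
  calc zl1 (pp l) * max 1 ‖S.θ‖ ^ (pp l).natDegree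
      ≤ ((pp l).natDegree + 1) * S.CfB m * max 1 ‖S.θ‖ ^ S.A₀ m :=
        mul_le_mul h1 h3 (by positivity) (by positivity)
    _ ≤ S.A₀ m * S.CfB m * max 1 ‖S.θ‖ ^ S.A₀ m := by gcongr

/-- **Level `m`, structural form** (Chudnovsky 1984, Ch. 7, pp. 306–308 and 318): for `m ≥ 1`,
`m ≥ m₁`, there is `Q ∈ ℤ[T]` — the norm of a nonzero small derivative `F^{(t)}(z_n)` — with
`Q(θ) ≠ 0` and explicit bounds for `deg Q`, `‖Q‖₁`, `|Q(θ)|`.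
[cite: Chudnovsky1984, Ch. 7 Thm 4.1 p. 318] -/
theorem level_struct (hm : 1 ≤ m) (hm₁ : S.m₁ ≤ m) :
    ∃ Q : ℤ[X], Polynomial.aeval S.θ Q ≠ 0 ∧
      Q.natDegree ≤ S.d * (S.A₀ m + S.nDeg m * S.δ₀) ∧
      zl1 Q ≤ ((S.d : ℝ) * S.HY m) ^ S.d ∧
      ‖Polynomial.aeval S.θ Q‖ ≤ S.valB m := by
  classical
  have hd1 := S.one_le_d
  -- Step 1: Siegel
  obtain ⟨pp, hpp0, hppdeg, hppB, hppeq⟩ := S.siegel_step m hm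
  set p : S.Λ m → ℂ := fun l => Polynomial.aeval S.θ (pp l) with hp
  have hp0 : p ≠ 0 := by
    obtain ⟨l, hl⟩ := Function.ne_iff.mp hpp0
    exact Function.ne_iff.mpr ⟨l, S.aeval_theta_ne_zero hl⟩
  have hK2 := S.one_le_K2
  have hm4 : m ^ 4 ≤ S.K2 * m ^ 4 := by
    calc m ^ 4 = 1 * m ^ 4 := (one_mul _).symm
      _ ≤ S.K2 * m ^ 4 := Nat.mul_le_mul_right _ hK2
  have hH0 : S.Hvan m p 0 := by
    intro n hn1 hn2 t ht
    rw [Xk_zero] at hn1 hn2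
    rw [Tk_zero] at ht
    have h := hppeq t ht ⟨n.1, hn1⟩ ⟨n.2, hn2⟩
    exact S.iteratedDeriv_F_eq_zero m pp ht (hn1.le.trans hm4) (hn2.le.trans hm4) h
  -- Step 2: the extrapolation
  have hCfB0 : 0 ≤ S.CfB m := by
    obtain ⟨l, -⟩ := Function.ne_iff.mp hpp0
    exact (abs_nonneg _).trans (hppB l 0)
  have hCp : ‖p‖ ≤ S.Cp m := S.norm_p_le m hppdeg hppB hCfB0
  obtain ⟨n₀, t₀, hn1, hn2, ht₀, hξ, hξle⟩ := S.exists_small_value m hm hm₁ hp0 hCp hH0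
  -- Step 3: the norm
  set Y := homEval S.E.N S.E.b (S.nDeg m) (S.Pmix m pp t₀ n₀) with hYdef
  have hHY0 : 0 ≤ S.HY m := by
    unfold HY
    have hl : 0 ≤ S.l1B m := le_trans zero_le_one (S.one_le_l1B m hm)
    have hH := S.H₀_nonneg
    positivity
  have hYentry : ∀ i j, zl1 (Y i j) ≤ S.HY m := fun i j =>
    S.zl1_entry_le m pp t₀ n₀ hm hCfB0 hppdeg hppB ht₀ hn1 hn2 i j
  have hYdeg : ∀ i j, (Y i j).natDegree ≤ S.A₀ m + S.nDeg m * S.δ₀ := fun i j =>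
    natDegree_homEval_entry_le S.natDegree_N_le S.natDegree_b_le
      (fun α hα => S.degree_le_of_mem_support_Pmix m pp ht₀ hn1.le hn2.le hα)
      (S.natDegree_coeff_Pmix_le m pp t₀ n₀ hppdeg) i j
  refine ⟨Y.det, S.aeval_det_ne_zero m pp t₀ n₀ ht₀ hn1.le hn2.le hξ, ?_, ?_, ?_⟩
  · exact S.natDegree_det_le m pp t₀ n₀ hppdeg ht₀ hn1.le hn2.le
  · exact zl1_det_le_of_entry hHY0 hYentry
  · refine (S.norm_aeval_det_le m pp t₀ n₀ hHY0 hYentry hYdeg ht₀ hn1.le hn2.le).trans ?_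
    unfold valB
    refine mul_le_mul_of_nonneg_right ?_ (by positivity)
    rw [norm_mul, norm_pow]
    exact mul_le_mul_of_nonneg_left hξle (by positivity)

end Level

end Setup

end Literature.NumberTheory.Transcendental.TubbsPeriods

end
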